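import Summits.CriticalPhenomena.PercolationContinuityZ3.Theorems.Transplant.SkelFrmFromBParamsReachFC
import Summits.CriticalPhenomena.PercolationContinuityZ3.Theorems.Transplant.SkelFrmBParamsReachFC
import Summits.CriticalPhenomena.PercolationContinuityZ3.Theorems.Transplant.SkelNegBParamsReachFC
import Summits.CriticalPhenomena.PercolationContinuityZ3.Theorems.Transplant.SkelPhiRootFoot
import Summits.CriticalPhenomena.PercolationContinuityZ3.Theorems.Transplant.SkelFrmFrom1SlotTypes
import Summits.CriticalPhenomena.PercolationContinuityZ3.Theorems.Transplant.SkelFrm1SlotTypes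
import Summits.CriticalPhenomena.PercolationContinuityZ3.Theorems.Transplant.SkelFrmFrom1ParamsPO
import Summits.CriticalPhenomena.PercolationContinuityZ3.Theorems.Transplant.SkelFrm1ParamsPO
import Summits.CriticalPhenomena.PercolationContinuityZ3.Theorems.Transplant.SkelFrmFrom1ParamsLBL
import Summits.CriticalPhenomena.PercolationContinuityZ3.Theorems.Transplant.SkelFrm1ParamsLBL
import Summits.CriticalPhenomena.PercolationContinuityZ3.Theorems.Transplant.SkelFrmFromBParamsKitA
import Summits.CriticalPhenomena.PercolationContinuityZ3.Theorems.Transplant.SkelFrmBParamsKitA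
import Summits.CriticalPhenomena.PercolationContinuityZ3.Theorems.Transplant.SkelFrmFromBParamsKitS
import Summits.CriticalPhenomena.PercolationContinuityZ3.Theorems.Transplant.SkelFrmBParamsKitS
import Summits.CriticalPhenomena.PercolationContinuityZ3.Theorems.Transplant.SkelFrmFrom1ParamsLF
import Summits.CriticalPhenomena.PercolationContinuityZ3.Theorems.Transplant.SkelFrm1ParamsLF
import Summits.CriticalPhenomena.PercolationContinuityZ3.Theorems.Transplant.SkelFrmFrom1ParamsLO
import Summits.CriticalPhenomena.PercolationContinuityZ3.Theorems.Transplant.SkelFrm1ParamsLO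
import Summits.CriticalPhenomena.PercolationContinuityZ3.Theorems.Transplant.SkelFrmFromBParamsLF
import Summits.CriticalPhenomena.PercolationContinuityZ3.Theorems.Transplant.SkelFrmBParamsLF
import Summits.CriticalPhenomena.PercolationContinuityZ3.Theorems.Transplant.SkelFrmFromBParamsFineSize
import Summits.CriticalPhenomena.PercolationContinuityZ3.Theorems.Transplant.SkelFrmBParamsFineSize
import Summits.CriticalPhenomena.PercolationContinuityZ3.Theorems.Transplant.SkelFrmFromBParamsLO
import Summits.CriticalPhenomena.PercolationContinuityZ3.Theorems.Transplant.SkelFrmBParamsLO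
import Summits.CriticalPhenomena.PercolationContinuityZ3.Theorems.Transplant.SkelFrmFromBParamsB
import Summits.CriticalPhenomena.PercolationContinuityZ3.Theorems.Transplant.SkelFrmBParamsB
import Summits.CriticalPhenomena.PercolationContinuityZ3.Theorems.Transplant.SkelFrmFromBParamsSlotsR
import Summits.CriticalPhenomena.PercolationContinuityZ3.Theorems.Transplant.SkelFrmBParamsSlotsR
import Summits.CriticalPhenomena.PercolationContinuityZ3.Theorems.Transplant.SkelFrmFromBParamsSlotsRS
import Summits.CriticalPhenomena.PercolationContinuityZ3.Theorems.Transplant.SkelFrmBParamsSlotsRS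
import Summits.CriticalPhenomena.PercolationContinuityZ3.Theorems.Transplant.SkelFrmFromBParamsSlots
import Summits.CriticalPhenomena.PercolationContinuityZ3.Theorems.Transplant.SkelFrmBParamsSlots
import Summits.CriticalPhenomena.PercolationContinuityZ3.Theorems.Transplant.SkelFrmFromBParamsSched
import Summits.CriticalPhenomena.PercolationContinuityZ3.Theorems.Transplant.SkelFrmBParamsSched
import Summits.CriticalPhenomena.PercolationContinuityZ3.Theorems.Transplant.SkelNegBParamsFoot
import Summits.CriticalPhenomena.PercolationContinuityZ3.Theorems.Transplant.PlanarSkeletonFrmFromDefs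
import Summits.CriticalPhenomena.PercolationContinuityZ3.Theorems.Transplant.PlanarSkeletonFrmDefs
import Summits.CriticalPhenomena.PercolationContinuityZ3.Theorems.Transplant.SkelPhiStepIDataNS
import HarnessLib
import Summits.CriticalPhenomena.PercolationContinuityZ3.Theorems.Transplant.SkelFrmBParamsFoot
/-!
# U-WAVE PORT (RULING D-U, lead g21 2026-08-26; WAVE-U-MANIFEST v3.1 row «SkelFrmBParamsFoot» ↦ «SkelFrmFromBParamsFoot») of the tree module
# `Transplant/SkelFrmBParamsFoot` onto the carrier `PlanarSkeletonFrmFrom` (frames only, cylinders connected from width `ℓ₀` on)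

ORIGINAL TITLE: N2 (frames-only node `SamePDropOfSkeletonFrmFrom₁`, OPEN) params column over `PlanarSkeletonFrm` — (ζ″) ledger, shape (B′) of record ((R-14)):

builds on p205010 (kernel theorem, internal audit signed; external expert review pending) — nothing in this file uses p205010; NOTHING is claimed about the
OPEN node U `SamePDropOfSkeletonFrmFrom₁` (nor U_s / the end state).  Lane `prim-bschramm`, seat `prim-bschramm-stmt` gen 26 (port pen, RULING M-11 family P-stmt; tool = p3-g26's port_u.py of record, registry-driven inputs); helper file
(`--supports stmt-CriticalPhenomena-4575 --as helper`).  PORT RULES r1–r4 of RULING D-U: declaration order and proof texts are those of the original,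
byte-identical except (i) the carrier token `PlanarSkeletonFrm ↦ PlanarSkeletonFrmFrom` (binders, `namespace`/`end` lines, qualified names of twinned
declarations), (ii) carrier-FREE declarations of the original (φ-level `Skelφ…` blocks and namespace-only arithmetic residents) are NOT re-declared —
this file imports the original and `export`s the twin-free residents (POLICY T / treatment (m1)); residents whose statement mentions a twinned
constant are copied, (iii) every carrier-binding declaration keeps its explicit binder `(Φ : PlanarSkeletonFrmFrom G)` in its own signature (r2).  Docstrings and citations are the original's.
-/

noncomputable section

open scoped Classical

namespace Summit.CriticalPhenomena.PercolationContinuityZ3.Theorems.Transplant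

/-! ## §1 Anisotropic fine containment -/

namespace Skelφ

open Literature.Probability.LatticeModels TwoAxis.Para

end Skelφ

/-! ## §2 The fine extents of record for a planar box at the frame record -/

namespace PlanarSkeletonFrmFrom

namespace NegB

open Literature.Probability.Percolation Literature.Probability.LatticeModels SimpleGraph
open SkelConc (Consts)
open Skelφ.StepI (DataN)
open TwoAxis.Para (modulus)
open Neg

section Values

/-- **The fine extent on axis `0`** of the planar box `[±sα] × [±sβ]`: `kFoot₀ := ⌈c₀·|A|·(|vβ|·sα + |vα|·sβ)/D⌉` (floor + 1). [this work] -/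
def kFoot₀ (κ : Consts) {V : Type} [DecidableEq V] [Countable V] {G : SimpleGraph V} [G.LocallyFinite] (Φ : PlanarSkeletonFrmFrom G) (t : V) (p : unitInterval) (D : Skelφ.StepI.DataNS V) (g : ℕ) (f : ℕ) (sα : ℤ) (sβ : ℤ) : ℤ := (prF κ Φ t p D g f).c₀ * (|(prF κ Φ t p D g f).A| * (|(prF κ Φ t p D g f).vβ| * sα + |(prF κ Φ t p D g f).vα| * sβ)) / (prF κ Φ t p D g f).D + 1

/-- **The fine extent on axis `1`**: `kFoot₁ := ⌈c₁·|A|·(|n|·sβ + |h|·sα)/D⌉` (floor + 1). [this work] -/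
def kFoot₁ (κ : Consts) {V : Type} [DecidableEq V] [Countable V] {G : SimpleGraph V} [G.LocallyFinite] (Φ : PlanarSkeletonFrmFrom G) (t : V) (p : unitInterval) (D : Skelφ.StepI.DataNS V) (g : ℕ) (f : ℕ) (sα : ℤ) (sβ : ℤ) : ℤ := (prF κ Φ t p D g f).c₁ * (|(prF κ Φ t p D g f).A| * (|(prF κ Φ t p D g f).n| * sβ + |(prF κ Φ t p D g f).h| * sα)) / (prF κ Φ t p D g f).D + 1

/-- **`hL0`** at `k₀ := kFoot₀`. [folklore] -/
theorem hL0_R (κ : Consts) {V : Type} [DecidableEq V] [Countable V] {G : SimpleGraph V} [G.LocallyFinite] (Φ : PlanarSkeletonFrmFrom G) (t : V) (p : unitInterval) (D : Skelφ.StepI.DataNS V) (g : ℕ) (f : ℕ) (sα : ℤ) (sβ : ℤ) (hN : EqNumL κ Φ t p D g f) :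
    (prF κ Φ t p D g f).c₀ * (|(prF κ Φ t p D g f).A| * (|(prF κ Φ t p D g f).vβ| * sα + |(prF κ Φ t p D g f).vα| * sβ)) ≤ kFoot₀ κ Φ t p D g f sα sβ * (prF κ Φ t p D g f).D := by
  have hD := (prF_pos κ Φ t p D g f hN).2.2.2.2.2
  unfold kFoot₀; rw [mul_comm _ (prF κ Φ t p D g f).D]; exact ceil_mul_le hD

/-- **`hL1`** at `k₁ := kFoot₁`. [folklore] -/
theorem hL1_R (κ : Consts) {V : Type} [DecidableEq V] [Countable V] {G : SimpleGraph V} [G.LocallyFinite] (Φ : PlanarSkeletonFrmFrom G) (t : V) (p : unitInterval) (D : Skelφ.StepI.DataNS V) (g : ℕ) (f : ℕ) (sα : ℤ) (sβ : ℤ) (hN : EqNumL κ Φ t p D g f) :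
    (prF κ Φ t p D g f).c₁ * (|(prF κ Φ t p D g f).A| * (|(prF κ Φ t p D g f).n| * sβ + |(prF κ Φ t p D g f).h| * sα)) ≤ kFoot₁ κ Φ t p D g f sα sβ * (prF κ Φ t p D g f).D := by
  have hD := (prF_pos κ Φ t p D g f hN).2.2.2.2.2
  unfold kFoot₁; rw [mul_comm _ (prF κ Φ t p D g f).D]; exact ceil_mul_le hD

/-- `0 ≤ kFoot₀`, `0 ≤ kFoot₁` for nonnegative extents (under the numeric long clause). [folklore] -/
theorem kFoot_nonneg (κ : Consts) {V : Type} [DecidableEq V] [Countable V] {G : SimpleGraph V} [G.LocallyFinite] (Φ : PlanarSkeletonFrmFrom G) (t : V) (p : unitInterval) (D : Skelφ.StepI.DataNS V) (g : ℕ) (f : ℕ) (sα : ℤ) (sβ : ℤ) (hN : EqNumL κ Φ t p D g f) (hα : 0 ≤ sα) (hβ : 0 ≤ sβ) : 0 ≤ kFoot₀ κ Φ t p D g f sα sβ ∧ 0 ≤ kFoot₁ κ Φ t p D g f sα sβ := by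
  obtain ⟨-, -, -, hc₀, hc₁, hD⟩ := prF_pos κ Φ t p D g f hN
  constructor
  · unfold kFoot₀
    have : 0 ≤ (prF κ Φ t p D g f).c₀ * (|(prF κ Φ t p D g f).A| * (|(prF κ Φ t p D g f).vβ| * sα + |(prF κ Φ t p D g f).vα| * sβ)) / (prF κ Φ t p D g f).D :=
      Int.ediv_nonneg (by positivity) hD.le
    linarith
  · unfold kFoot₁
    have : 0 ≤ (prF κ Φ t p D g f).c₁ * (|(prF κ Φ t p D g f).A| * (|(prF κ Φ t p D g f).n| * sβ + |(prF κ Φ t p D g f).h| * sα)) / (prF κ Φ t p D g f).D :=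
      Int.ediv_nonneg (by positivity) hD.le
    linarith

/-- **THE PACKAGED READING** (map slot `φ′`): a vertex within planar extents `(sα, sβ)` of the base vertex `t` has fine position within `(kFoot₀, kFoot₁)`. [folklore] -/
theorem abs_fine_le_of_near₂ (κ : Consts) {V : Type} [DecidableEq V] [Countable V] {G : SimpleGraph V} [G.LocallyFinite] (Φ : PlanarSkeletonFrmFrom G) (t : V) (p : unitInterval) (D : Skelφ.StepI.DataNS V) (g : ℕ) (f : ℕ) (sα : ℤ) (sβ : ℤ) (hN : EqNumL κ Φ t p D g f) {φ' : V → Site 2} {w : V} (h0 : |φ' w 0 - φ' t 0| ≤ sα) (h1 : |φ' w 1 - φ' t 1| ≤ sβ) :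
    |fine κ Φ t p D g f φ' w 0| ≤ kFoot₀ κ Φ t p D g f sα sβ ∧ |fine κ Φ t p D g f φ' w 1| ≤ kFoot₁ κ Φ t p D g f sα sβ := by
  obtain ⟨-, -, -, hc₀, hc₁, hD⟩ := prF_pos κ Φ t p D g f hN
  have hψ : fine κ Φ t p D g f φ' = (prF κ Φ t p D g f).ψ φ' t := (prF_ψ κ Φ t p D g f φ').symm
  have h := Skelφ.fine_containment₂ (φ := φ') t (s₀ := (prF κ Φ t p D g f).D / 2) (s₁ := (prF κ Φ t p D g f).D / 2) hD hc₀.le hc₁.le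
    (hL0_R κ Φ t p D g f sα sβ hN) (hL1_R κ Φ t p D g f sα sβ hN) h0 h1
  have h0' := fine_base_at κ Φ t p D g f φ' hN
  rw [hψ] at h0' ⊢
  unfold Skelφ.FinePrm.ψ at h h0' ⊢
  rw [h0'] at h
  simpa using h

end Values

end NegB

end PlanarSkeletonFrmFrom

/-! ## §3 Fine containment from the LATTICE FUNCTIONALS (located stmt-g14 2026-08-21T19:4xZ: per-axis extents still over-read a sheared region — steep long pair
`|h_L| ≈ 10 n_L` with `n_L ≫ ℓ_L`; the functionals `v_β·Δ₀ − v_α·Δ₁` and `n·Δ₁ − h·Δ₀` are read directly) -/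

namespace Skelφ

open Literature.Probability.LatticeModels TwoAxis.Para

end Skelφ

end Summit.CriticalPhenomena.PercolationContinuityZ3.Theorems.Transplant

end
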